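import Mathlib.Analysis.Asymptotics.Defs
import Mathlib.Analysis.SpecificLimits.Basic
import Mathlib.Analysis.SpecificLimits.Normed
import Mathlib.Data.Nat.NthRoot.Defs
import Mathlib.Tactic.DeriveFintype
import Literature.Computability.Complexity.Classes
import Literature.Computability.Complexity.Nondeterministic
import Literature.Computability.Complexity.Transducers
import Literature.Computability.Complexity.PairingMachines
import Literature.Computability.Complexity.BinarySubtraction
import Literature.Computability.Complexity.CookReducibilityTransitive
import Literature.Computability.Complexity.ReductionsProofs
import HarnessLib

/-!
# `NSUBEXP` and the time-constructibility of `2^{nᵏ}`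

Trunk `CplxCore` (Boolean complexity). Over the tree's verifier-form `NTIME`
(`Nondeterministic.lean`) and Sipser-form `IsTimeConstructible` (`Classes.lean`) this file
provides:

* `NSUBEXP = ⋂_{ε>0} NTIME(2^{n^ε})`, realised as `⋂_{r>0} NTIME(2^{⌊n^{1/r}⌋})` with
  Mathlib's integer root `Nat.nthRoot r n = ⌊n^{1/r}⌋` — *exactly* the hypothesis form of
  **pnp.S39** `Literature.Computability.AlgebraicComplexity.kabanets_impagliazzo` (`ValiantBooleanBridge.lean`), with its unfolding
  and the members `NSUBEXP ⊆ NTIME(2^{⌊n^{1/r}⌋})`, `NSUBEXP ⊆ NTIME(2ⁿ)`, and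
  `NTIME(2^{n²}) ⊆ NEXP`;
* `TimeConstructible.isTimeConstructible_two_pow_pow` — **proved**: `2^{nᵏ}` (`1 ≤ k`) is time
  constructible in the tree's sense (Arora–Barak 2009, §1.3: "examples of time-constructible
  functions are `n, n log n, n², 2ⁿ`"): the map `1ⁿ ↦ bin 2^{nᵏ} = 0^{nᵏ}1` is the composite of
  the tree's unary pad `padFn (X ^ k)` with two finite-state transductions (`dblT`, `binT`), hence
  polynomial time, and every polynomial is `≤ c · 2^{nᵏ} + c`; in particular `2ⁿ` and `2^{n²}`
  (`isTimeConstructible_two_pow`, `isTimeConstructible_two_pow_sq`);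
* `isLittleO_two_pow_succ_two_pow_sq` — `2^{n+1} = o(2^{n²})`.

The last two items are exactly the side conditions of the instance `f = 2ⁿ`, `g = 2^{n²}` of the
nondeterministic time hierarchy theorem (`Literature.Computability.Complexity.ntime_hierarchy`, `Williams2014.lean`;
Arora–Barak 2009, Thm. 3.2) behind "`NEXP ⊆ NTIME(2ⁿ)` contradicts the hierarchy theorem" in
the Kabanets–Impagliazzo argument (Arora–Barak 2009, proof of Thm. 20.17); the instance itself
(`NTIME(2^{n²}) ⊄ NTIME(2ⁿ)`, `NEXP ⊄ NSUBEXP`) is drawn where the fact is imported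
(`AlgebraicComplexity/ValiantBooleanBridgeProofs.lean`), keeping this file's imports inside the
machine toolkit of `Complexity/`.

## Design notes

* `NTIME t` of the tree is the verifier form with the explicit bound `c * t n + c` on both the
  certificate length and the verification time; it is *not* provably monotone in `t` without
  time-constructibility (`NTIME_mono` is itself a named fact), so every statement here is phrased
  with the literal bounds `fun n => 2 ^ n`, `fun n => 2 ^ (n ^ 2)`, `fun n => 2 ^ Nat.nthRoot r n`
  that occur in `NEXP = ⋃ₖ NTIME(2^{nᵏ})` and in pnp.S39; in particular
  `NTIME (fun n => 2 ^ (n ^ 2)) ⊆ NEXP` and `NSUBEXP ⊆ NTIME (fun n => 2 ^ n)` (`r = 1`,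
  `Nat.nthRoot 1 n = n` by `rfl`) need no monotonicity.
* `f(n+1) = o(g(n))` in `ntime_hierarchy` is Mathlib's `Asymptotics.IsLittleO` at `Filter.atTop`
  on the real casts; `isLittleO_two_pow_succ_two_pow_sq` is stated in exactly that shape.
* `SUBEXP` (`Classes.lean`, deterministic) realises `ε = 1/k` with `⌈n^{1/k}⌉₊` and `Real.rpow`;
  for the nondeterministic class we follow pnp.S39 and use the floor `Nat.nthRoot` (no reals).
  The two roundings differ by at most one in the exponent, i.e. by a factor `2` in the bound,
  which the `c * t n + c` closure absorbs for deterministic classes; for `NTIME` we do not claim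
  (nor need) the comparison.
* Machines: none is programmed by hand; `dblT` (bit doubling, so that `boolUnpair` reads a raw
  unary string as a first pair component) and `binT` (`⟨1ᵐ, []⟩ ↦ 0ᵐ1`) are `FST`s
  (`Transducers.lean`, linear time), `padFn` is the tree's Horner-clock pad
  (`CookReducibilityTransitive.lean`), `rePair` the pair normaliser (`PairingMachines.lean`);
  composition by `comp_mem_FP`, transport to the encoders `unaryEncodeNat`/`encodeNat` of
  `IsTimeConstructible` by `PolyTimeComputable.of_encode`.

## References

* S. A. Cook, *A hierarchy for nondeterministic time complexity*, J. Comput. System Sci. 7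
  (1973) 343–353 (STOC 1972).
* J. Seiferas, M. Fischer, A. Meyer, *Separating nondeterministic time complexity classes*,
  J. ACM 25 (1978) 146–167; S. Žák, *A Turing machine time hierarchy*, Theoret. Comput. Sci. 26
  (1983) 327–333.
* S. Arora, B. Barak, *Computational Complexity: A Modern Approach*, CUP 2009, Thm. 3.2 (p. 69),
  §1.3 (p. 16, time-constructible functions), §2.6.2 (`NEXP`), proof of Thm. 20.17 (p. 418).
* V. Kabanets, R. Impagliazzo, *Derandomizing polynomial identity tests means proving circuit
  lower bounds*, STOC 2003, §2.1 (`NSUBEXP = ∩_{ε>0} NTIME(2^{n^ε})`), proof of Thm. 18 (p. 359).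
-/

noncomputable section

namespace Literature.Computability.Complexity

open Filter Asymptotics Topology

/-! ### `NSUBEXP` -/

/-- The class `NSUBEXP = ⋂_{ε>0} NTIME(2^{n^ε})` of languages decidable in nondeterministic
subexponential time (Kabanets–Impagliazzo 2003, §2.1), the intersection over real `ε > 0` being
realised over the cofinal family `ε = 1/r`, `r : ℕ`, `0 < r`, with the integer root
`Nat.nthRoot r n = ⌊n^{1/r}⌋` — literally the hypothesis
`∀ r, 0 < r → L ∈ NTIME (fun n => 2 ^ Nat.nthRoot r n)` of pnp.S39
(`Literature.Computability.AlgebraicComplexity.kabanets_impagliazzo`), see `mem_NSUBEXP_iff`.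
[cite: KabanetsImpagliazzo2003, §2.1 (p. 357)] -/
def NSUBEXP : Set (Language Bool) :=
  ⋂ (r : ℕ) (_ : 0 < r), NTIME (fun n => 2 ^ Nat.nthRoot r n)

/-- Unfolding `NSUBEXP`: membership is membership in every `NTIME(2^{⌊n^{1/r}⌋})`, `0 < r`.
[cite: KabanetsImpagliazzo2003, §2.1 (p. 357)] -/
theorem mem_NSUBEXP_iff {L : Language Bool} :
    L ∈ NSUBEXP ↔ ∀ r : ℕ, 0 < r → L ∈ NTIME (fun n => 2 ^ Nat.nthRoot r n) := by
  simp only [NSUBEXP, Set.mem_iInter]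

/-- `NSUBEXP ⊆ NTIME(2^{⌊n^{1/r}⌋})` for every `0 < r`. [cite: KabanetsImpagliazzo2003, §2.1 (p. 357)] -/
theorem NSUBEXP_subset_NTIME_nthRoot {r : ℕ} (hr : 0 < r) :
    NSUBEXP ⊆ NTIME (fun n => 2 ^ Nat.nthRoot r n) :=
  fun _ hL => mem_NSUBEXP_iff.1 hL r hr

/-- `NSUBEXP ⊆ NTIME(2ⁿ)`: the member `r = 1` of the intersection (`Nat.nthRoot 1 n = n`
definitionally). [cite: KabanetsImpagliazzo2003, §2.1 (p. 357)] -/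
theorem NSUBEXP_subset_NTIME_two_pow : NSUBEXP ⊆ NTIME (fun n => 2 ^ n) :=
  NSUBEXP_subset_NTIME_nthRoot Nat.one_pos

/-- `NTIME(2^{n²}) ⊆ NEXP` (the member `k = 2` of `NEXP = ⋃ₖ NTIME(2^{nᵏ})`).
[cite: AroraBarakCC2009, §2.6.2 (NEXP)] -/
theorem NTIME_two_pow_sq_subset_NEXP : NTIME (fun n => 2 ^ (n ^ 2)) ⊆ NEXP :=
  Set.subset_iUnion (fun k : ℕ => NTIME (fun n => 2 ^ (n ^ k))) 2

/-! ### Time-constructibility of `2^{nᵏ}` (proved) -/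

namespace TimeConstructible

open _root_.Computability Polynomial

/-- The bit-doubling transducer `b₁ b₂ … ↦ b₁ b₁ b₂ b₂ …`: it turns a raw string `w` into a word
that `boolUnpair` reads as the pair `(w, [])` (`boolUnpair_flatMap`). [folklore] -/
def dblT : FST Unit Bool Bool where
  init := ()
  step := fun _ b => ((), [b, b])
  front := fun _ => []
  keep := fun _ => true

/-- The transition of `dblT` (definitional). [folklore] -/
@[simp] theorem dblT_step (s : Unit) (b : Bool) : dblT.step s b = ((), [b, b]) := rfl

/-- The body emitted by `dblT`. [folklore] -/
theorem dblT_run (w : List Bool) : (dblT.run () w).2 = w.flatMap fun b => [b, b] := by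
  induction w with
  | nil => rfl
  | cons b w ih => rw [FST.run_cons, dblT_step, ih, List.flatMap_cons]

/-- `dblT` doubles every bit. [folklore] -/
theorem dblT_eval (w : List Bool) : dblT.eval w = w.flatMap fun b => [b, b] := by
  rw [FST.eval, show dblT.init = () from rfl, show ∀ s, dblT.keep s = true from fun _ => rfl,
    show ∀ s, dblT.front s = [] from fun _ => rfl, if_pos rfl, List.nil_append, dblT_run]

/-- `boolUnpair` reads a doubled string (no separator) as the pair `(w, [])` (its junk-tolerant
end case). [folklore] -/
theorem boolUnpair_flatMap (w : List Bool) : boolUnpair (w.flatMap fun b => [b, b]) = (w, []) := by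
  induction w with
  | nil => rfl
  | cons b w ih => simp [List.flatMap_cons, boolUnpair, ih]

/-- States of `binT`: between pairs, inside a pair (first bit read), done. [folklore] -/
inductive PS
  | ev
  | od (b : Bool)
  | dead
  deriving DecidableEq, Fintype

/-- The transducer `⟨1ᵐ, rest⟩ ↦ 0ᵐ1`: read the pair code two bits at a time; an equal pair emits
`0`, the separator `01` emits the final `1`, after which nothing is emitted. [folklore] -/
def binT : FST PS Bool Bool where
  init := .ev
  step := fun s c => match s with
    | .ev => (.od c, [])
    | .od b => if b = c then (.ev, [false]) else (.dead, [true])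
    | .dead => (.dead, [])
  front := fun _ => []
  keep := fun _ => true

/-- The transition of `binT` between pairs (definitional). [folklore] -/
@[simp] theorem binT_step_ev (c : Bool) : binT.step .ev c = (.od c, []) := rfl

/-- The transition of `binT` inside a pair (definitional). [folklore] -/
@[simp] theorem binT_step_od (b c : Bool) :
    binT.step (.od b) c = (if b = c then (.ev, [false]) else (.dead, [true])) := rfl

/-- The transition of `binT` in the dead state (definitional). [folklore] -/
@[simp] theorem binT_step_dead (c : Bool) : binT.step .dead c = (.dead, []) := rfl

/-- The dead state emits nothing. [folklore] -/
theorem binT_run_dead (w : List Bool) : (binT.run .dead w).2 = [] := by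
  induction w with
  | nil => rfl
  | cons b w ih => rw [FST.run_cons, binT_step_dead, ih]; rfl

/-- `binT` on `⟨1ᵐ, rest⟩` emits `0ᵐ1`. [folklore] -/
theorem binT_run_ev (m : ℕ) (rest : List Bool) :
    (binT.run .ev (boolPair (List.replicate m true) rest)).2 = List.replicate m false ++ [true] := by
  induction m with
  | zero =>
    rw [List.replicate_zero, show boolPair [] rest = false :: true :: rest from rfl, FST.run_cons,
      binT_step_ev, FST.run_cons, binT_step_od, if_neg (by decide), binT_run_dead]
    rfl
  | succ m ih =>
    have hc : boolPair (List.replicate (m + 1) true) rest =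
        true :: true :: boolPair (List.replicate m true) rest := by
      simp [boolPair, List.replicate_succ]
    rw [hc, FST.run_cons, binT_step_ev, FST.run_cons, binT_step_od, if_pos rfl, ih,
      List.replicate_succ]
    rfl

/-- `binT ⟨1ᵐ, []⟩ = 0ᵐ1`. [folklore] -/
theorem binT_eval (m : ℕ) :
    binT.eval (boolPair (List.replicate m true) []) = List.replicate m false ++ [true] := by
  rw [FST.eval, show binT.init = PS.ev from rfl, show ∀ s, binT.keep s = true from fun _ => rfl,
    show ∀ s, binT.front s = [] from fun _ => rfl, if_pos rfl, List.nil_append, binT_run_ev]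

/-- The string map `1ⁿ ↦ 0^{nᵏ}1 = bin 2^{nᵏ}`: double, pad to `1^{nᵏ}` (`padFn (X ^ k)`), double,
normalise to `⟨1^{nᵏ}, []⟩` (`rePair`), transduce by `binT`. [folklore] -/
def powFn (k : ℕ) : List Bool → List Bool :=
  binT.eval ∘ rePair ∘ dblT.eval ∘ OracleCompose.padFn (X ^ k) ∘ dblT.eval

/-- `powFn k ∈ FP` (finite-state transductions, the unary pad and the pair normaliser are in
`FP`, which is closed under composition). [folklore] -/
theorem powFn_mem_FP (k : ℕ) : powFn k ∈ FP :=
  comp_mem_FP binT.polyTimeComputable_eval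
    (comp_mem_FP rePair_mem_FP
      (comp_mem_FP dblT.polyTimeComputable_eval
        (comp_mem_FP (OracleCompose.padFn_mem_FP _) dblT.polyTimeComputable_eval)))

/-- `powFn k (1ⁿ) = bin 2^{nᵏ}`; the numeral identity `bin 2ᵐ = 0ᵐ1` (the tree's
`TavRecode.encodeNat_two_pow` / `SIS.encodeNat_two_pow_eq_replicate`, re-derived inline from
`encodeNat_bitsToNat` to keep this file's imports inside `Complexity/`). [folklore] -/
theorem powFn_unary (k n : ℕ) : powFn k (unaryEncodeNat n) = encodeNat (2 ^ (n ^ k)) := by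
  have hbin : ∀ m : ℕ, encodeNat (2 ^ m) = List.replicate m false ++ [true] := fun m => by
    have h : bitsToNat (List.replicate m false ++ [true]) = 2 ^ m := by
      rw [bitsToNat_append, bitsToNat_replicate_false, List.length_replicate]
      simp
    rw [← h, encodeNat_bitsToNat (isCanonicalNum_append_true _)]
  simp only [powFn, Function.comp, OracleCompose.unaryEncodeNat_eq_replicate, dblT_eval,
    OracleCompose.padFn_apply, boolUnpair_flatMap, List.length_replicate, eval_pow, eval_X, rePair,
    binT_eval, hbin]

/-- `n ↦ 2^{nᵏ}` is polynomial-time computable from unary input to binary output. [folklore] -/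
theorem polyTimeComputable_two_pow_pow (k : ℕ) :
    PolyTimeComputable unaryEncodeNat encodeNat (fun n : ℕ => 2 ^ (n ^ k)) :=
  (powFn_mem_FP k).of_encode (g := unaryEncodeNat) (fun _ => rfl) fun n => powFn_unary k n

/-- `nᵈ ≤ C · 2ⁿ` for a constant `C = C(d)` (from `nᵈ / 2ⁿ → 0`). [folklore] -/
theorem exists_pow_le_mul_two_pow (d : ℕ) : ∃ C : ℕ, ∀ n : ℕ, n ^ d ≤ C * 2 ^ n := by
  have ht := tendsto_pow_const_div_const_pow_of_one_lt d (one_lt_two (α := ℝ))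
  have hev : ∀ᶠ n : ℕ in atTop, (n : ℝ) ^ d / 2 ^ n ≤ 1 := ht.eventually (ge_mem_nhds one_pos)
  obtain ⟨N, hN⟩ := eventually_atTop.1 hev
  refine ⟨∑ i ∈ Finset.range N, i ^ d + 1, fun n => ?_⟩
  by_cases hn : N ≤ n
  · have h := hN n hn
    rw [div_le_one (by positivity)] at h
    have h' : n ^ d ≤ 2 ^ n := by exact_mod_cast h
    calc n ^ d ≤ 2 ^ n := h'
      _ ≤ (∑ i ∈ Finset.range N, i ^ d + 1) * 2 ^ n := Nat.le_mul_of_pos_left _ (by omega)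
  · have hlt : n < N := lt_of_not_ge hn
    have h1 : n ^ d ≤ ∑ i ∈ Finset.range N, i ^ d :=
      Finset.single_le_sum (f := fun i => i ^ d) (fun _ _ => Nat.zero_le _)
        (Finset.mem_range.2 hlt)
    calc n ^ d ≤ ∑ i ∈ Finset.range N, i ^ d + 1 := by omega
      _ ≤ (∑ i ∈ Finset.range N, i ^ d + 1) * 2 ^ n := Nat.le_mul_of_pos_right _ (Nat.two_pow_pos n)

/-- Every polynomial is dominated by `c · 2^{nᵏ} + c` (`1 ≤ k`). [folklore] -/
theorem exists_poly_le_two_pow_pow (p : Polynomial ℕ) {k : ℕ} (hk : 1 ≤ k) :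
    ∃ c : ℕ, ∀ n : ℕ, p.eval n ≤ c * 2 ^ (n ^ k) + c := by
  obtain ⟨c₁, d, h₁⟩ := exists_eval_le_mul_pow_add p
  obtain ⟨C, hC⟩ := exists_pow_le_mul_two_pow d
  refine ⟨c₁ * C + c₁, fun n => ?_⟩
  have h2 : 2 ^ n ≤ 2 ^ (n ^ k) := Nat.pow_le_pow_right Nat.two_pos (Nat.le_self_pow (by omega) n)
  calc p.eval n ≤ c₁ * n ^ d + c₁ := h₁ n
    _ ≤ c₁ * (C * 2 ^ n) + c₁ := by gcongr; exact hC n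
    _ ≤ c₁ * (C * 2 ^ (n ^ k)) + c₁ := by gcongr
    _ ≤ (c₁ * C + c₁) * 2 ^ (n ^ k) + (c₁ * C + c₁) := by nlinarith [Nat.one_le_two_pow (n := n ^ k)]

/-- **`2^{nᵏ}` is time constructible** (`1 ≤ k`), in the tree's Sipser form: `n ≤ 2^{nᵏ}`, and
`1ⁿ ↦ bin 2^{nᵏ}` is computed by the polynomial-time machine of `powFn k`, whose running time is
`≤ c · 2^{nᵏ} + c`. (Arora–Barak 2009, §1.3, p. 16: `n²`, `2ⁿ` are among the standard examples.)
[cite: AroraBarakCC2009, §1.3 (p. 16)] -/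
theorem isTimeConstructible_two_pow_pow {k : ℕ} (hk : 1 ≤ k) :
    IsTimeConstructible fun n => 2 ^ (n ^ k) := by
  refine ⟨fun n => ?_, ?_⟩
  · exact Nat.lt_two_pow_self.le.trans (Nat.pow_le_pow_right Nat.two_pos (Nat.le_self_pow (by omega) n))
  · obtain ⟨p, M, hM⟩ := polyTimeComputable_two_pow_pow k
    obtain ⟨c, hc⟩ := exists_poly_le_two_pow_pow p hk
    refine ⟨c, M, fun n => (hM n).mono ?_⟩
    have hl : (unaryEncodeNat n).length = n := by
      rw [OracleCompose.unaryEncodeNat_eq_replicate, List.length_replicate]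
    simp only [hl]
    exact hc n

/-- **`2ⁿ` is time constructible** (Arora–Barak 2009, §1.3, p. 16: "Examples for
time-constructible functions are `n`, `n log n`, `n²`, `2ⁿ`"). [cite: AroraBarakCC2009, §1.3 (p. 16)] -/
theorem isTimeConstructible_two_pow : IsTimeConstructible fun n => 2 ^ n := by
  have h := isTimeConstructible_two_pow_pow le_rfl
  simp only [pow_one] at h
  exact h

/-- **`2^{n²}` is time constructible.** [cite: AroraBarakCC2009, §1.3 (p. 16)] -/
theorem isTimeConstructible_two_pow_sq : IsTimeConstructible fun n => 2 ^ (n ^ 2) :=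
  isTimeConstructible_two_pow_pow one_le_two

end TimeConstructible

/-! ### The growth condition `2^{n+1} = o(2^{n²})` -/

/-- The growth condition of Thm. 3.2 for `f = 2ⁿ`, `g = 2^{n²}`: `2^{n+1} = o(2^{n²})`
(for `n ≥ 2`, `2^{n+1} / 2^{n²} ≤ 2 · (1/2)ⁿ → 0`). [folklore] -/
theorem isLittleO_two_pow_succ_two_pow_sq :
    (fun n : ℕ => (((2 : ℕ) ^ (n + 1) : ℕ) : ℝ)) =o[atTop] fun n : ℕ => (((2 : ℕ) ^ (n ^ 2) : ℕ) : ℝ) := by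
  have hg : ∀ n : ℕ, (((2 : ℕ) ^ (n ^ 2) : ℕ) : ℝ) ≠ 0 := fun n => by positivity
  refine (isLittleO_iff_tendsto fun n h => absurd h (hg n)).2 ?_
  -- squeeze between `0` and `2 * (1/2)^n`
  have hlim : Tendsto (fun n : ℕ => (2 : ℝ) * (1 / 2) ^ n) atTop (𝓝 0) := by
    simpa using (tendsto_pow_atTop_nhds_zero_of_lt_one
      (show (0 : ℝ) ≤ 1 / 2 by norm_num) (show (1 : ℝ) / 2 < 1 by norm_num)).const_mul (2 : ℝ)
  refine tendsto_of_tendsto_of_tendsto_of_le_of_le' tendsto_const_nhds hlim ?_ ?_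
  · exact Eventually.of_forall fun n => by positivity
  · refine (eventually_ge_atTop 2).mono fun n hn => ?_
    have h2 : (0 : ℝ) < (2 : ℝ) ^ (n ^ 2) := by positivity
    rw [Nat.cast_pow, Nat.cast_pow, Nat.cast_ofNat, div_le_iff₀ h2]
    -- `2^(n+1) ≤ 2 * (1/2)^n * 2^(n^2)` since `2 n ≤ n ^ 2`
    have hnn : n + n ≤ n ^ 2 := by nlinarith
    obtain ⟨d, hd⟩ := Nat.exists_eq_add_of_le hnn
    have hpow : (2 : ℝ) ^ (n ^ 2) = 2 ^ n * 2 ^ n * 2 ^ d := by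
      rw [hd, pow_add, pow_add]
    rw [hpow, pow_succ]
    have h1 : (1 / 2 : ℝ) ^ n * 2 ^ n = 1 := by
      rw [← mul_pow]; norm_num
    have hd1 : (1 : ℝ) ≤ 2 ^ d := one_le_pow₀ (by norm_num)
    have hn0 : (0 : ℝ) < 2 ^ n := by positivity
    calc (2 : ℝ) ^ n * 2 = 2 * ((1 / 2 : ℝ) ^ n * 2 ^ n) * 2 ^ n * 1 := by rw [h1]; ring
      _ ≤ 2 * ((1 / 2 : ℝ) ^ n * 2 ^ n) * 2 ^ n * 2 ^ d := by gcongr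
      _ = 2 * (1 / 2) ^ n * (2 ^ n * 2 ^ n * 2 ^ d) := by ring

end Literature.Computability.Complexity

end
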